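import Summits.BirchSwinnertonDyer.Rank1Residual.X11b.Three.GaloisImageNegOne
import Summits.BirchSwinnertonDyer.Rank1Residual.X11b.Three.ImageAtThree
import Literature.NumberTheory.EllipticCurves.SerreOpenImageDeterminantProofs
import HarnessLib

/-!
# X11b at `p = 3` (team N8/O2, LINE-K sub-target E-K7, algebraic core): COMMUTATOR DESCENT of `−1`
# — over ℚ, `ρ̄_{E,3}` onto ⟹ every subgroup `H ≤ Γ_ℚ` containing the commutators of an index-2
# subgroup (= `Γ_F` for `F` abelian over a quadratic `K`) has an element acting as `−1` on `E[3]`,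
# hence on `E[3^m]`, hence `H¹ = 0` and no `H`-fixed `3`-power torsion (cell `b2b-bsdres`,
# team `x11b3`, seat p7)

HONEST FRAMING (verbatim, cell `b2b-bsdres`, run/shared/lean/b2b/bsd-rank1-residual/): the goal of
the cell is to DELETE the COMBINATION-SHAPED residual classes for ALL analytic-rank `≤ 1` curves
over `ℚ` — "full BSD formula for every rank `≤ 1` curve in class `C`" assembled STRICTLY from
published theorems — so that the rank-`≤ 1` remainder becomes exactly the CONSTRUCTION-SHAPED
classes, which are TYPED (missing-input Props), NOT attempted; this is not "finishing BSD".
Research route (team N8/O2: STEP L at `3 ‖ N`; LINE K); ELEMENTARY group theory + Galois-module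
algebra; nothing booked; no label touched; X11b@3 stays OPEN (RESIDUAL-MAP §I O2). THEOREMS ONLY;
no definition; no named fact; no `sorry`.

## Why (r2, `cells/x11b3/LINE-K.md` block 3, U3 = sub-target E-K7)

McCallum's structure theorem works over the RING CLASS FIELDS `K_n` of the Heegner field `K`
(`n ∈ S_r(M)`): `K_n/K` is ABELIAN of even degree, so the odd-index inheritance of
`Three/ImageSahTower.lean` (made for the anticyclotomic `ℤ₃`-tower) does not reach `G_{K_n}`. The
substitute is a COMMUTATOR DESCENT: `G_{K_n} ⊇ [G_K, G_K]` (abelian quotient), `[G_ℚ : G_K] = 2`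
forces `ρ̄_{E,3}(G_K) ⊇ SL₂(𝔽₃)` when `ρ̄_{E,3}` is onto (team S6), and `−1 ∈ [SL₂(𝔽₃), SL₂(𝔽₃)]`
(`−1 = [i, j]` in the quaternion group `Q₈`). Hence SOME element of `G_{K_n}` acts as `−1` on `E[3]`;
`Three/GaloisImageNegOne.lean` §4 then gives `−1 ∈ ρ_{E,3^M}(G_{K_n})`, `H¹ = 0` and no fixed
`3^M`-torsion at EVERY level `M` — McCallum §3 (2)–(3) / Gross Prop. 9.1 and §4 (5) at `p = 3` from
`Surj W 3` ALONE (with p2's E-K8 this supports downgrading the vendored fact's `3`-adic tower binder to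
the printed mod-`3` hypothesis — the referee's call).

* §1 abstract: `exists_mem_of_mem_commutator_map` — for `ρ : Γ →* A`, `Γ' ≤ Γ`, `H ≤ Γ` with
  `⁅Γ', Γ'⁆ ≤ H`: every element of `⁅ρ(Γ'), ρ(Γ')⁆` is `ρ h` for some `h ∈ H`.
* §2 `GL₂(𝔽₃)`: `GL2F3.negOne_mem_commutator_ker_det` — `−1 ∈ [SL₂(𝔽₃), SL₂(𝔽₃)]` (explicit
  `i = (0 −1; 1 0)`, `j = (1 1; 1 −1)` with `ij = −ji`); transport to any `A ≅ GL₂(𝔽₃)`: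
  `GL2F3.symm_negOne_mem_commutator_of_index_two_map` — for `ρ : Γ ↠ A` and `Γ'` of index `2`,
  `e⁻¹(−1) ∈ ⁅ρ(Γ'), ρ(Γ')⁆` (p1's `map_eq_top_or_eq_ker_of_index_two`: `ρ(Γ') ⊇ ker det`).
* §3 over `ℚ` (Serre's frame `exists_frame_galoisRepTorsion_rat`: `Aut(E[3]) ≅ GL₂(𝔽₃)` with
  `e(g x) = Φ(g) e(x)`, so `Φ(−1) = −1`): **`exists_mem_smul_eq_neg_three_of_index_two`** — `E/ℚ`
  with `ρ̄_{E,3}` onto, `Γ' ≤ Γ_ℚ` of index `2`, `H ≤ Γ_ℚ` with `⁅Γ', Γ'⁆ ≤ H` ⟹ `∃ h ∈ H`, `h` acts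
  as `−1` on `E[3]`; and the level-`3^m` consequences **`exists_mem_smul_eq_neg_pow_of_index_two`**
  (`∃ h ∈ H` acting as `−1` on `E[3^m]`), **`restrict_range_crossedHom_principal_of_index_two`**
  (`H¹(ρ_{3^m}(H), E[3^m]) = 0`: crossed homomorphisms of `((galoisRepTorsion W 3^m).restrict H).range`
  principal), **`geomTorsion_pow_eq_zero_of_forall_mem_smul_eq_of_index_two`** (`E[3^m]^H = 0`).

Dictionary (r2's U3): `Γ' = G_K` (any quadratic `K`, `K = ℚ(√−3)` INCLUDED — then `ρ̄(G_K) = SL₂(𝔽₃)`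
still contains `Q₈ ∋ −1`), `H = G_{K_n}` or `G_F` for any `F ⊇ K` with `F/K` abelian
(`⁅G_K, G_K⁆ ≤ G_F`). What this is NOT: the identification of a concrete `F ⊂ ℚ̄` (ring class
field) with a subgroup `H ≤ Γ_ℚ` satisfying `⁅Γ', Γ'⁆ ≤ H` is Galois theory the consumer supplies;
nothing about elliptic curves beyond `Surj W 3`; nothing booked.

References: C.-H. Sah, J. Algebra 10 (1968) Prop. 2.7 (b) [Sah1968]; T. Lawson, C. Wuthrich, Springer
PROMS 188 (2016) Lemma 3 [LawsonWuthrich2016]; J.-P. Serre, Invent. Math. 15 (1972) §5.2 [Serre1972];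
W. G. McCallum, LMS LN 153 (1991) §3 (2)–(3), §4 (5) [McCallumLMS1991]; team `cells/x11b3/LINE-K.md`
block 3 (U1–U5, E-K7).
-/

namespace Summit.BirchSwinnertonDyer.Rank1Residual.X11b.Three

open scoped commutatorElement

/-! ### §1. Abstract commutator descent -/

section Abstract

variable {Γ A : Type*} [Group Γ] [Group A]

/-- **Commutator descent.** For `ρ : Γ →* A`, a subgroup `Γ' ≤ Γ` and a subgroup `H ≤ Γ` containing
the commutator subgroup `⁅Γ', Γ'⁆` (e.g. `H ⊴ Γ'` with abelian quotient): every element of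
`⁅ρ(Γ'), ρ(Γ')⁆` is the image of an element of `H`. [folklore] -/
theorem exists_mem_of_mem_commutator_map (ρ : Γ →* A) (Γ' H : Subgroup Γ) (hH : ⁅Γ', Γ'⁆ ≤ H)
    {z : A} (hz : z ∈ ⁅Γ'.map ρ, Γ'.map ρ⁆) : ∃ h ∈ H, ρ h = z := by
  rw [← Subgroup.map_commutator, Subgroup.mem_map] at hz
  obtain ⟨c, hc, rfl⟩ := hz
  exact ⟨c, hH hc, rfl⟩

end Abstract

/-! ### §2. `−1` is a commutator of `SL₂(𝔽₃)`, and its transport to any `A ≅ GL₂(𝔽₃)` -/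

namespace GL2F3

open Matrix

/-- **`−1 ∈ [SL₂(𝔽₃), SL₂(𝔽₃)]`**: `−1 = [i, j]` for the quaternion pair `i = (0 −1; 1 0)`,
`j = (1 1; 1 −1)` of determinant `1` (`ij = −ji`). [folklore] -/
theorem negOne_mem_commutator_ker_det :
    negOne ∈ ⁅(Matrix.GeneralLinearGroup.det : GL (Fin 2) (ZMod 3) →* (ZMod 3)ˣ).ker,
      (Matrix.GeneralLinearGroup.det : GL (Fin 2) (ZMod 3) →* (ZMod 3)ˣ).ker⁆ := by
  have h0 : Matrix.det !![(0 : ZMod 3), -1; 1, 0] ≠ 0 := by decide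
  have h1 : Matrix.det !![(1 : ZMod 3), 1; 1, -1] ≠ 0 := by decide
  have hi : Matrix.GeneralLinearGroup.mkOfDetNeZero _ h0 ∈
      (Matrix.GeneralLinearGroup.det : GL (Fin 2) (ZMod 3) →* (ZMod 3)ˣ).ker := by
    rw [mem_ker_det_iff]; decide +revert
  have hj : Matrix.GeneralLinearGroup.mkOfDetNeZero _ h1 ∈
      (Matrix.GeneralLinearGroup.det : GL (Fin 2) (ZMod 3) →* (ZMod 3)ˣ).ker := by
    rw [mem_ker_det_iff]; decide +revert
  have hcomm : ⁅Matrix.GeneralLinearGroup.mkOfDetNeZero _ h0,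
      Matrix.GeneralLinearGroup.mkOfDetNeZero _ h1⁆ = negOne := by
    rw [commutatorElement_def]
    apply Matrix.GeneralLinearGroup.ext
    intro a b
    have hinv_i : ((Matrix.GeneralLinearGroup.mkOfDetNeZero _ h0)⁻¹ : GL (Fin 2) (ZMod 3)) =
        Matrix.GeneralLinearGroup.mkOfDetNeZero !![(0 : ZMod 3), 1; -1, 0] (by decide) := by
      rw [inv_eq_iff_mul_eq_one]
      apply Matrix.GeneralLinearGroup.ext
      decide +revert
    have hinv_j : ((Matrix.GeneralLinearGroup.mkOfDetNeZero _ h1)⁻¹ : GL (Fin 2) (ZMod 3)) =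
        Matrix.GeneralLinearGroup.mkOfDetNeZero !![(-1 : ZMod 3), -1; -1, 1] (by decide) := by
      rw [inv_eq_iff_mul_eq_one]
      apply Matrix.GeneralLinearGroup.ext
      decide +revert
    rw [hinv_i, hinv_j]
    clear hinv_i hinv_j hi hj
    revert a b
    decide +revert
  rw [← hcomm]
  exact Subgroup.commutator_mem_commutator hi hj

variable {A : Type*} [Group A] (e : A ≃* GL (Fin 2) (ZMod 3)) {Γ : Type*} [Group Γ]

/-- **Transport: for a surjection `ρ : Γ ↠ A ≅ GL₂(𝔽₃)` and `Γ' ≤ Γ` of index `2`, the element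
`e⁻¹(−1)` lies in `⁅ρ(Γ'), ρ(Γ')⁆`.** By p1's `map_eq_top_or_eq_ker_of_index_two`, `ρ(Γ')` is all of
`A` or the kernel of `det ∘ e`; either way it contains `e⁻¹(SL₂(𝔽₃))`, whose commutator subgroup
contains `e⁻¹(−1)`. [folklore] -/
theorem symm_negOne_mem_commutator_map_of_index_two (ρ : Γ →* A) (hρ : Function.Surjective ρ)
    (Γ' : Subgroup Γ) (hΓ' : Γ'.index = 2) :
    e.symm negOne ∈ ⁅Γ'.map ρ, Γ'.map ρ⁆ := by
  -- `e⁻¹(SL₂) ≤ ρ(Γ')`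
  have hker : ∀ x : GL (Fin 2) (ZMod 3),
      x ∈ (Matrix.GeneralLinearGroup.det : GL (Fin 2) (ZMod 3) →* (ZMod 3)ˣ).ker →
        e.symm x ∈ Γ'.map ρ := by
    intro x hx
    rcases map_eq_top_or_eq_ker_of_index_two e ρ hρ Γ' hΓ' with htop | hkerΓ
    · rw [htop]; exact Subgroup.mem_top _
    · obtain ⟨a, ha⟩ := hρ (e.symm x)
      have haΓ : a ∈ Γ' := by
        rw [hkerΓ, MonoidHom.mem_ker, MonoidHom.comp_apply, MonoidHom.comp_apply, ha,
          MulEquiv.coe_toMonoidHom, MulEquiv.apply_symm_apply]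
        exact hx
      exact ⟨a, haΓ, ha⟩
  have hmap : (⁅(Matrix.GeneralLinearGroup.det : GL (Fin 2) (ZMod 3) →* (ZMod 3)ˣ).ker,
      (Matrix.GeneralLinearGroup.det : GL (Fin 2) (ZMod 3) →* (ZMod 3)ˣ).ker⁆.map
        e.symm.toMonoidHom) ≤ ⁅Γ'.map ρ, Γ'.map ρ⁆ := by
    rw [Subgroup.map_commutator]
    apply Subgroup.commutator_mono <;>
    · rintro _ ⟨x, hx, rfl⟩
      exact hker x hx
  exact hmap ⟨negOne, negOne_mem_commutator_ker_det, rfl⟩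

end GL2F3

end Summit.BirchSwinnertonDyer.Rank1Residual.X11b.Three

/-! ### §3. Over `ℚ`: an element of `H` acting as `−1` on `E[3]`, and the level-`3^m` consequences -/

namespace WeierstrassCurve

open Matrix Summit.BirchSwinnertonDyer.Rank1Residual.X11b.Three
open scoped commutatorElement

variable (W : WeierstrassCurve ℚ) [W.IsElliptic]

omit [W.IsElliptic] in
/-- In Serre's frame `(e, Φ)` of `E[3]` (`e (g x) = Φ(g) e(x)`), the negation automorphism maps to
the scalar `−1 ∈ GL₂(𝔽₃)`. [folklore] -/
theorem frame_ofAdd_neg_eq_negOne [Fact (Nat.Prime 3)]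
    (e : W.geomTorsion ((3 : ℕ) : ℤ) ≃+ (Fin 2 → ZMod 3))
    (Φ : Multiplicative (AddAut (W.geomTorsion ((3 : ℕ) : ℤ))) ≃* GL (Fin 2) (ZMod 3))
    (he : ∀ (g : Multiplicative (AddAut (W.geomTorsion ((3 : ℕ) : ℤ))))
      (x : W.geomTorsion ((3 : ℕ) : ℤ)),
      e (Multiplicative.toAdd g x) = ((Φ g : GL (Fin 2) (ZMod 3)) : Matrix (Fin 2) (Fin 2) (ZMod 3)) *ᵥ e x) :
    Φ (Multiplicative.ofAdd (AddEquiv.neg (W.geomTorsion ((3 : ℕ) : ℤ)))) = GL2F3.negOne := by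
  set g := Multiplicative.ofAdd (AddEquiv.neg (W.geomTorsion ((3 : ℕ) : ℤ))) with hg
  have hv : ∀ v : Fin 2 → ZMod 3,
      ((Φ g : GL (Fin 2) (ZMod 3)) : Matrix (Fin 2) (Fin 2) (ZMod 3)) *ᵥ v = -v := fun v ↦ by
    obtain ⟨x, rfl⟩ := e.surjective v
    rw [← he, ← map_neg]
    rfl
  apply Matrix.GeneralLinearGroup.ext
  intro a b
  have h := congrFun (hv (Pi.single b 1)) a
  rw [Matrix.mulVec_single_one, Matrix.col_apply] at h
  rw [GL2F3.val_negOne, Matrix.neg_apply, Matrix.one_apply, h, Pi.neg_apply, Pi.single_apply]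

/-- **E-K7 core: an element of `H` acting as `−1` on `E[3]`.** For `E/ℚ` with `ρ̄_{E,3}` onto, a
subgroup `Γ' ≤ Γ_ℚ` of index `2` (= `G_K`, `K` quadratic; `ℚ(√−3)` allowed) and any subgroup
`H ≤ Γ_ℚ` containing `⁅Γ', Γ'⁆` (= `G_F` for `F ⊇ K` abelian over `K`, e.g. McCallum's ring class
fields `K_n`): SOME `h ∈ H` acts as `−1` on `E[3]`. (Serre's frame; `ρ̄(G_K) ⊇ SL₂(𝔽₃)`;
`−1 ∈ [SL₂(𝔽₃), SL₂(𝔽₃)]`; commutator descent.) [cite: Serre1972, §5.2 (iii)–(iv)] -/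
theorem exists_mem_smul_eq_neg_three_of_index_two [Fact (Nat.Prime 3)]
    (hsurj : W.HasSurjectiveModNGaloisRep ((3 : ℕ) : ℤ)) (Γ' : Subgroup (Field.absoluteGaloisGroup ℚ))
    (hΓ' : Γ'.index = 2) (H : Subgroup (Field.absoluteGaloisGroup ℚ)) (hH : ⁅Γ', Γ'⁆ ≤ H) :
    ∃ h ∈ H, ∀ P : W.geomTorsion ((3 : ℕ) : ℤ), h • P = -P := by
  obtain ⟨e, Φ, he, -⟩ := exists_frame_galoisRepTorsion_rat W 3
  have hmem := GL2F3.symm_negOne_mem_commutator_map_of_index_two Φ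
    (galoisRepTorsion W ((3 : ℕ) : ℤ)) hsurj Γ' hΓ'
  obtain ⟨h, hhH, hρh⟩ := exists_mem_of_mem_commutator_map _ Γ' H hH hmem
  refine ⟨h, hhH, fun P ↦ ?_⟩
  have hneg : galoisRepTorsion W ((3 : ℕ) : ℤ) h =
      Multiplicative.ofAdd (AddEquiv.neg (W.geomTorsion ((3 : ℕ) : ℤ))) := by
    rw [hρh, MulEquiv.symm_apply_eq, W.frame_ofAdd_neg_eq_negOne e Φ he]
  rw [← galoisRepTorsion_apply, hneg]
  rfl

/-- **Level `3^m`: an element of `H` acting as `−1` on `E[3^m]`** (`h^{3^{m−1}}` for the `h` of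
`exists_mem_smul_eq_neg_three_of_index_two`; basis-free lift). [cite: LawsonWuthrich2016, Lemma 3] -/
theorem exists_mem_smul_eq_neg_pow_of_index_two [Fact (Nat.Prime 3)]
    (hsurj : W.HasSurjectiveModNGaloisRep ((3 : ℕ) : ℤ)) (Γ' : Subgroup (Field.absoluteGaloisGroup ℚ))
    (hΓ' : Γ'.index = 2) (H : Subgroup (Field.absoluteGaloisGroup ℚ)) (hH : ⁅Γ', Γ'⁆ ≤ H)
    {m : ℕ} (hm : 1 ≤ m) :
    ∃ h ∈ H, ∀ x : W.geomTorsion ((3 ^ m : ℕ) : ℤ), h • x = -x := by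
  obtain ⟨h, hhH, hh⟩ := W.exists_mem_smul_eq_neg_three_of_index_two hsurj Γ' hΓ' H hH
  refine ⟨h ^ 3 ^ (m - 1), H.pow_mem hhH _, ?_⟩
  exact smul_pow_three_pow_eq_neg hm (W.nsmul_eq_zero_geomTorsion_pow m)
    (fun x hx ↦ W.smul_eq_neg_geomTorsion_pow_of_three_nsmul hh m x hx)

/-- **`H¹(ρ_{E,3^m}(H), E[3^m]) = 0`** for such `H` (crossed homomorphisms of the image
`((galoisRepTorsion W 3^m).restrict H).range ≤ Aut(E[3^m])` are principal): McCallum §3 (2)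
injectivity / Gross Prop. 9.1 over `K_n` at `p = 3`, from `Surj W 3` alone.
[cite: Sah1968, Prop. 2.7 (b) and its proof, p. 60] [cite: McCallumLMS1991, §3 (2)–(3) (p. 298)] -/
theorem restrict_range_crossedHom_principal_of_index_two [Fact (Nat.Prime 3)]
    (hsurj : W.HasSurjectiveModNGaloisRep ((3 : ℕ) : ℤ)) (Γ' : Subgroup (Field.absoluteGaloisGroup ℚ))
    (hΓ' : Γ'.index = 2) (H : Subgroup (Field.absoluteGaloisGroup ℚ)) (hH : ⁅Γ', Γ'⁆ ≤ H)
    {m : ℕ} (hm : 1 ≤ m)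
    (f : ((W.galoisRepTorsion ((3 ^ m : ℕ) : ℤ)).restrict H).range → W.geomTorsion ((3 ^ m : ℕ) : ℤ))
    (hf : ∀ g g' : ((W.galoisRepTorsion ((3 ^ m : ℕ) : ℤ)).restrict H).range,
      f (g * g') =
        Multiplicative.toAdd (g : Multiplicative (AddAut (W.geomTorsion ((3 ^ m : ℕ) : ℤ))))
          (f g') + f g) :
    ∃ a : W.geomTorsion ((3 ^ m : ℕ) : ℤ),
      ∀ g : ((W.galoisRepTorsion ((3 ^ m : ℕ) : ℤ)).restrict H).range,
        f g =
          Multiplicative.toAdd (g : Multiplicative (AddAut (W.geomTorsion ((3 ^ m : ℕ) : ℤ)))) a - a := by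
  obtain ⟨h, hhH, hh⟩ := W.exists_mem_smul_eq_neg_pow_of_index_two hsurj Γ' hΓ' H hH hm
  refine exists_eq_sub_of_crossedHom_of_neg_mem (Odd.pow (by decide) : Odd (3 ^ m))
    (W.nsmul_eq_zero_geomTorsion_pow m) _ (z := W.galoisRepTorsion ((3 ^ m : ℕ) : ℤ) h)
    (MonoidHom.mem_range.mpr ⟨⟨h, hhH⟩, rfl⟩) (fun x ↦ ?_) f hf
  rw [galoisRepTorsion_apply]
  exact hh x

/-- **`E[3^m]^H = 0`** for such `H`: no non-zero point of `E[3^m]` is fixed by all of `H`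
(McCallum §4 (5) "no `K_n`-rational `p`-torsion" at `p = 3`, from `Surj W 3` alone). [folklore] -/
theorem geomTorsion_pow_eq_zero_of_forall_mem_smul_eq_of_index_two [Fact (Nat.Prime 3)]
    (hsurj : W.HasSurjectiveModNGaloisRep ((3 : ℕ) : ℤ)) (Γ' : Subgroup (Field.absoluteGaloisGroup ℚ))
    (hΓ' : Γ'.index = 2) (H : Subgroup (Field.absoluteGaloisGroup ℚ)) (hH : ⁅Γ', Γ'⁆ ≤ H)
    {m : ℕ} (hm : 1 ≤ m) {x : W.geomTorsion ((3 ^ m : ℕ) : ℤ)}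
    (hfix : ∀ h ∈ H, h • x = x) : x = 0 := by
  obtain ⟨h, hhH, hh⟩ := W.exists_mem_smul_eq_neg_pow_of_index_two hsurj Γ' hΓ' H hH hm
  have h1 := hh x
  rw [hfix h hhH] at h1
  have h2 : (2 : ℕ) • x = 0 := by rw [two_nsmul]; nth_rw 2 [h1]; exact add_neg_cancel x
  exact TorsionLift.eq_zero_of_two_nsmul_eq_zero_of_odd_nsmul_eq_zero (Odd.pow (by decide))
    (W.nsmul_eq_zero_geomTorsion_pow m x) h2

end WeierstrassCurve
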